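import Mathlib
import Summits.MatrixMultiplication.MatrixMultiplication.Theses.FourierTwoFamiliesModP

/-!
# Strategist sketch — crux `PrimeTwoFamilies` (stmt-MatrixMultiplication-14308)

First lemma of crux idea `equi-difference-normal-form` (lens: strengthen): the EQUI-DIFFERENCE strengthening
S⁺ = `EquiDifferenceTwoFamilies` (all block difference sets `A i - B i` equal to ONE set `F`, cross differences
avoid `F`) implies the crux in two lines, with NO mediator index left in clause (X).
Every SDPP design on record (translates, CKSU Prop 24 and its radix/CRT images, one-way-carry staggered designs)
is equi-difference (folder/calc/equidiff.py), so S⁺ is consistent with all data; it is NOT claimed to be easier.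
-/

set_option linter.dupNamespace false

namespace Summit.MatrixMultiplication.MatrixMultiplication.Cruxes.PrimeTwoFamilies.Strategist

open Finset
open scoped Pointwise
open Summit.MatrixMultiplication.MatrixMultiplication.Theses

/-- **S⁺ = equi-difference two-families designs** in prime cyclic hosts: the crux's clauses (W), host and size
verbatim, and clause (X) replaced by the STRONGER mediator-free pair "every `A i - B i` equals one set `F`" and
"cross difference sets `A i - B k` (`i ≠ k`) avoid `F`". -/
def EquiDifferenceTwoFamilies : Prop :=
  ∀ δ : ℝ, 0 < δ → ∀ n₀ : ℕ, ∃ n ≥ n₀, ∃ p : ℕ, p.Prime ∧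
    ∃ (A B : Fin n → Finset (ZMod p)) (F : Finset (ZMod p)),
      (∀ i : Fin n, ∀ a ∈ A i, ∀ a' ∈ A i, ∀ b ∈ B i, ∀ b' ∈ B i,
          (a - a') + (b - b') = 0 → a = a' ∧ b = b') ∧
      (∀ i : Fin n, A i - B i = F) ∧
      (∀ i k : Fin n, i ≠ k → Disjoint (A i - B k) F) ∧
      (p : ℝ) ≤ (n : ℝ) ^ (2 + δ) ∧
      ∀ i : Fin n, (n : ℝ) ^ (2 - δ) ≤ (((A i).card * (B i).card : ℕ) : ℝ)

/-- **First lemma (proved): S⁺ → crux.**  Clause (X) at `(i,j,k)`: `a - a' + b - b' = 0` gives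
`a - b' = a' - b ∈ A j - B j = F`, while `a - b' ∈ A i - B k` is disjoint from `F` unless `i = k`. -/
theorem primeTwoFamilies_of_equiDifference (h : EquiDifferenceTwoFamilies) :
    FourierTwoFamiliesModP.PrimeTwoFamilies := by
  intro δ hδ n₀
  obtain ⟨n, hn, p, hp, A, B, F, hW, hF, hX, hpn, hAB⟩ := h δ hδ n₀
  refine ⟨n, hn, p, hp, A, B, hW, ?_, hpn, hAB⟩
  intro i j k a ha a' ha' b hb b' hb' h0
  by_contra hik
  have h1 : a - b' = a' - b := by
    have h2 : (a - a') + (b - b') = (a - b') - (a' - b) := by abel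
    rw [h2] at h0
    exact sub_eq_zero.1 h0
  have hmem1 : a - b' ∈ A i - B k := Finset.sub_mem_sub ha hb'
  have hmem2 : a' - b ∈ F := by
    rw [← hF j]
    exact Finset.sub_mem_sub ha' hb
  rw [← h1] at hmem2
  exact Finset.disjoint_left.1 (hX i k hik) hmem1 hmem2

/-- In an equi-difference design clause (W) makes `(a, b) ↦ a - b` injective on `A i ×ˢ B i`, so every block has
the SAME co-volume `|A i| * |B i| = |F|` (the common difference set is a rainbow difference set of every block). -/
theorem card_mul_card_eq_of_equiDifference {p n : ℕ} (A B : Fin n → Finset (ZMod p)) (F : Finset (ZMod p))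
    (hW : ∀ i : Fin n, ∀ a ∈ A i, ∀ a' ∈ A i, ∀ b ∈ B i, ∀ b' ∈ B i,
      (a - a') + (b - b') = 0 → a = a' ∧ b = b')
    (hF : ∀ i : Fin n, A i - B i = F) (i : Fin n) :
    (A i).card * (B i).card = F.card := by
  classical
  set f : ZMod p × ZMod p → ZMod p := fun x => x.1 - x.2 with hf
  have hinj : Set.InjOn f ↑(A i ×ˢ B i) := by
    intro x hx y hy hxy
    rw [Finset.mem_coe, Finset.mem_product] at hx hy
    have hxy' : x.1 - x.2 = y.1 - y.2 := hxy
    have h0 : (x.1 - y.1) + (y.2 - x.2) = 0 := by linear_combination hxy'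
    obtain ⟨h1, h2⟩ := hW i x.1 hx.1 y.1 hy.1 y.2 hy.2 x.2 hx.2 h0
    exact Prod.ext h1 h2.symm
  have himage : (A i ×ˢ B i).image f = A i - B i := by
    ext z
    simp only [hf, Finset.mem_image, Finset.mem_product, Finset.mem_sub, Prod.exists]
    constructor
    · rintro ⟨a, b, ⟨ha, hb⟩, rfl⟩
      exact ⟨a, ha, b, hb, rfl⟩
    · rintro ⟨a, ha, b, hb, rfl⟩
      exact ⟨a, b, ⟨ha, hb⟩, rfl⟩
  calc (A i).card * (B i).card = (A i ×ˢ B i).card := (Finset.card_product _ _).symm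
    _ = ((A i ×ˢ B i).image f).card := (Finset.card_image_of_injOn hinj).symm
    _ = (A i - B i).card := by rw [himage]
    _ = F.card := by rw [hF i]

end Summit.MatrixMultiplication.MatrixMultiplication.Cruxes.PrimeTwoFamilies.Strategist
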